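/-
# `Balaban1983to89.B5SupFactor125Torus` — Bałaban CMP 95 (1984), Proposition 1.2, step S1 AS PRINTED on the torus of record:
# THE FACTOR ESTIMATES (1.125), (1.129), (1.130) OF THE DIRECT WALK (1.123) for `G = Δ_a⁻¹`, from the global inequalities
# (1.115)–(1.117) («The factors with G are estimated by using (1.115)», p. 38)

statement-level skeleton of published theorems with citation tags; proofs where landed; nothing here is a claim
about the Yang–Mills mass gap

CITATION HEADER (lean-in-tree rule).  Cell `lit-balaban`, unit `lit-balaban-p38` (Phase-2 proof seat p38 gen 8), HOME
`run/shared/lean/pub/lit-balaban/` (SKELETON rows B5.Eq1.125, B5.Eq1.129, B5.Eq1.130, B5.Eq1.115-1.117, B5.Prop1.2; owner r02).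
B5 = T. Bałaban, *Propagators and renormalization transformations for lattice gauge theories. I*, Commun. Math. Phys. **95**
(1984) 17–40 [`Balaban1984PropagatorsI`], held as `paper:balaban1984-cmp95-propagators-rt-i` (journal page = PDF page + 16).
FILE C of the p38-gen-8 half (DomCert side) of the sup/Hölder (S1) torus instantiation of `B5SupWalkS1.SupRealisation`
(B5-CLOSURE §5 item 2); FILES A/B = `B5SupCarrierTorus` / `B5SupHolderTorus`.

WHAT IS PRINTED (p. 37–38 [PDF 21–22], verbatim; renders certified in `B5SupWalk125`): «There are two types of factors, with
the operator G and with the operator K(h). The factors with G are estimated by using (1.115). For the first factor we have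
‖ζ∇h_zGh_zA‖_α ≤ O(1)(‖ζ‖_α + |ζ|)|h_zA|. (1.125)» … «The last factor in each term is estimated by using (1.115), (1.116)
|∇Gh_z∇*J| + |Gh_z∇*J| ≤ O(1)(‖J‖_ε + |J|) ≤ O(1)(‖J‖_{α+ε} + |J|). (1.129)  There is one possibility left yet, namely that
of the terms with one factor. Then we apply the inequality (1.117) together with (1.115), (1.116) and we get
‖ζ∇h_zGh_z∇*J‖_α ≤ O(1)(‖ζ‖_α + |ζ|)(‖J‖_{α+ε} + |J|). (1.130)»; p. 36 (1.115)–(1.117): «|GJ|, |∇GJ|, |G∇*J|, |ΔGJ|,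
‖∇GJ‖_α, ‖G∇*J‖_α ≤ O(1)|J|, (1.115)  |∇G∇*J| ≤ O(1)(‖J‖_ε + |J|), (1.116)  ‖∇G∇*J‖_α ≤ O(1)(‖J‖_{α+ε} + |J|), (1.117)».

WHAT THIS MODULE PROVES (kernel-checked, zero sorry) — for the REAL setting of record `latticeSettingP12R n M a k`, `G = Gs n M a`
(pv15՚s `GR`), the multipliers `h_z` (`gz`) of the cube partition, `M₀ ≥ 1`, under the typed hypothesis
`hG : B5.Global115_117 (latticeSettingP12R n M a k) (gP12R M n a k) C Cα Cε Cαε` (with `0 < C`):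
§1 the remaining READINGS of (1.115)–(1.117) on real fields (`|ΔGB| ≤ C|B|`, `‖∇GB‖_α ≤ C_α(α)|B|`, `‖G∇*T‖_α ≤ C_α(α)|T|`,
   `|∇G∇*T| ≤ C_ε(ε)(‖T‖_ε + |T|)`, `‖∇G∇*T‖_α ≤ C_{α,ε}(α,ε)(‖T‖_{α+ε} + |T|)`; files A/B give the others);
§2 GENERIC PAIR ESTIMATES for the Hölder quotient of products with the cut-off `ζ`, with `h_z` and with `∇h_z`;
§3 **(1.125) FOR THE FOUR KINDS OF DIRECT OUTPUT FUNCTIONALS** (evaluation `A ↦ A(b)`, `A ↦ (∇_νA)(b)`, `A ↦ (ΔA)(b)` for (1.110),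
   (1.112), and the Hölder quotient `A ↦ |x−x′|^{−α}[(ζ∇A)_{νμ}(x′) − (ζ∇A)_{νμ}(x)]` for (1.111)/(1.113)): `|D(h_zGB)| ≤ c·A·s₁·|B|`
   with the printed sizes `s₁ = 1` resp. `‖ζ‖_α + |ζ|` and `A` linear in `C`, `C_α(α)` — e.g. `quotH_gz_G_le`:
   `|x−x′|^{−α}|(ζ∇h_zGB)_{νμ}(x′) − (ζ∇h_zGB)_{νμ}(x)| ≤ cFH·(C + C_α(α))·(‖ζ‖_α + |ζ|)·|B|`, and the same without `h_z`
   (the remainder clause of `B5SupWalk131.Adm`);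
§4 **(1.129), DIRECT SOURCES**: `|∇Gh_zJ| + |Gh_zJ| ≤ 2C|J|` (vector source) and `|∇Gh_z∇*T| + |Gh_z∇*T| ≤ cLT·(C + C_ε(ε))·(‖T‖_ε + |T|)`
   (tensor source, via `h_z∇*T = ∇*(h_zT) + E_zT` of `B5WalkLeibnizTorus.mul_divTR_eq` and `‖h_zT‖_ε ≤ ‖T‖_ε + (Lw/M₀)|T|`), with
   the printed second inequality `‖T‖_ε ≤ ‖T‖_{α+ε}` (`B5SupHolderTorus.holderL_mono`);
§5 **(1.130), THE ONE-FACTOR TERMS** `|D(h_zGh_z·src)|` for every (output kind, source kind) the certificates need, in particular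
   `‖ζ∇h_zGh_z∇*J‖_α ≤ O(1)(‖ζ‖_α + |ζ|)(‖J‖_{α+ε} + |J|)` read at a pair (`quotH_gz_G_gz_divTR_le`) from (1.117) with (1.115), (1.116).

HONEST SCOPE / DIVERGENCE.  (1) The estimates are proved AS PRINTED in content — each from the typed (1.115)–(1.117) of the
instance by the Leibniz/Hölder calculus of FILE B — but READ AT ONE PAIR / ONE POINT (the output functionals of the walk machine
`B5SupWalk125`/`131`), which is how (1.131) consumes them («we estimate the norm … by the sum of norms»); the seminorm-level
(1.125) is the supremum of these.  (2) Constants ours, explicit, linear in the (1.115)–(1.117) constants (so that they fit the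
envelope `B5SupWalk131.env`), uniform in `η`, the volume, `k` and `M₀ ≥ 1`; `α ≤ 1` is all that the pair estimates use
(print: `0 ≤ α < 1`, needed only inside (1.115)–(1.117) themselves).  (3) The adjoint sources (monopole / `ζ`-dipole on the `ℓ¹`
carrier, p. 39) are FILE C′ (`B5SupFactor129AdjTorus`).  CELL BOOK-KEEPING (lit-balaban): rows B5.Eq1.125 / B5.Eq1.129 /
B5.Eq1.130 («torus instance for G of record, direct walk»), B5.Eq1.115-1.117 (readings), B5.Prop1.2 (S1-torus programme, p38
half, file C) — cells only, NO head change; value = the printed factor estimates kernel-checked for Bałaban՚s G, NOT summit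
progress.
  v1.1 (p38 gen 9, DOCFIX ONLY — second-reader note r05 22-(b) = referee note ref-4 S-B5-g39-1): page numeral of
«The factors with G are estimated by using (1.115).» in the title corrected p. 37 → p. 38 [PDF 22 L5–6] (the sentence
opens p. 38; the walk (1.123)–(1.124) it refers to is on p. 37); declarations byte-identical.
-/
import Mathlib
import Literature.MathematicalPhysics.QuantumFieldTheory.Balaban1983to89.B5SupHolderTorus
import Literature.MathematicalPhysics.QuantumFieldTheory.Balaban1983to89.B5Remark36Derivatives
import Literature.MathematicalPhysics.QuantumFieldTheory.Balaban1983to89.B5WalkCertsTorus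

open Finset

namespace Literature.MathematicalPhysics.QuantumFieldTheory.Balaban1983to89.B5SupFactor125Torus

open scoped BigOperators Matrix
open Literature.MathematicalPhysics.QuantumFieldTheory.Balaban1983to89
open Literature.MathematicalPhysics.QuantumFieldTheory.Balaban1983to89.B5Prop11Plancherel (Tor fine unitVec)
open Literature.MathematicalPhysics.QuantumFieldTheory.Balaban1983to89.B5Prop11Lattice (grad divT)
open Literature.MathematicalPhysics.QuantumFieldTheory.Balaban1983to89.B5Prop11Lower (Lap)
open Literature.MathematicalPhysics.QuantumFieldTheory.Balaban1983to89.B5Prop12FieldsLattice (cdistF distU cubeT cubeB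
  supNormL holderL holderV holderT cutSupL cutHL distU_nonneg distU_self)
open Literature.MathematicalPhysics.QuantumFieldTheory.Balaban1983to89.B5RealFields (GR fdiffR gradR divTR LapR cplx
  cplx_GR_mulVec cplx_gradR cplx_divTR isReal_Lap)
open Literature.MathematicalPhysics.QuantumFieldTheory.Balaban1983to89.B5SettingP12Real (LocR VecR latticeSettingP12R gP12R)
open Literature.MathematicalPhysics.QuantumFieldTheory.Balaban1983to89.B5WalkTorusGeom (TorR ucPt Cen)
open Literature.MathematicalPhysics.QuantumFieldTheory.Balaban1983to89.B5WalkCarrierTorus (Bnd)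
open Literature.MathematicalPhysics.QuantumFieldTheory.Balaban1983to89.B5CombesThomasLattice (nb)
open Literature.MathematicalPhysics.QuantumFieldTheory.Balaban1983to89.B5WalkH128Torus (pb gz abs_gz_le_one abs_gz_sub_le
  fdiffR_mulVec_apply K2 K2_nonneg)
open Literature.MathematicalPhysics.QuantumFieldTheory.Balaban1983to89.B5WalkLeibnizTorus (gradR_mul_eq Ediv mul_divTR_eq
  Kmix Kmix_nonneg)
open Literature.MathematicalPhysics.QuantumFieldTheory.Balaban1983to89.B5CoverP12Lattice (Lw Lw_nonneg distU_comm
  nearOf mem_cubeB_nearOf)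
open Literature.MathematicalPhysics.QuantumFieldTheory.Balaban1983to89.LatticeNorms (supNorm supNorm_le norm_le_supNorm
  supNorm_nonneg holderSeminormB5)
open Literature.MathematicalPhysics.QuantumFieldTheory.Balaban1983to89.B5SupCarrierTorus (Gs Gs_apply Dgs Dgs_apply
  supNorm_cplx_eq supNorm_ten_cplx_eq setting_supNorm_vec setting_supNorm_ten norm_le_of_cubewise norm_ten_le_of_cubewise
  norm_Gs_le_of_global norm_Dgs_Gs_le_of_global norm_Gs_divTR_le_of_global)
open Literature.MathematicalPhysics.QuantumFieldTheory.Balaban1983to89.B5SupHolderTorus (abs_le_norm abs_le_norm_ten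
  norm_le_of_forall_abs_le norm_ten_le_of_forall_abs_le abs_fdiffR_le abs_sub_le_distU_mul norm_gz_mul_le abs_dgz_le
  norm_gradR_gz_mul_le norm_Ediv_le abs_LapR_gz_mul_le dgz norm_dgz_le norm_gradR_dgz_le holS holS_nonneg abs_le_cutSupL
  cutSupL_nonneg' abs_sub_le_holS_mul abs_sub_le_holderV_mul abs_sub_le_holderT_mul le_rpow_self_of_le_one holderV_le_grad
  holderV_dgz_le abs_mul_sub_mul_le holderL_mono holderT_gz_mul_le)

open Literature.MathematicalPhysics.QuantumFieldTheory.Balaban1983to89.B5Remark36Derivatives (distU_add_right)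
open Literature.MathematicalPhysics.QuantumFieldTheory.Balaban1983to89.B5WalkCertsTorus (Lw_div_le gradR_add)

noncomputable section

variable {d : ℕ}

/-! ## §1 The remaining readings of (1.115)–(1.117) on real fields -/

section Readings

variable {n : ℕ} [NeZero n] {M : Fin d → ℕ} [hM : ∀ μ, NeZero (M μ)] {a : ℝ} (k : ℕ)
  {C : ℝ} {Cα Cε : ℝ → ℝ} {Cαε : ℝ → ℝ → ℝ}

/-- `Δ` on real fields complexifies to the typed `Lap`. [cite: Balaban1984PropagatorsI, (1.90) p.33 (Δ)] -/
theorem cplx_LapR_mulVec (v : VecR n M) : cplx (LapR n M *ᵥ v) = Lap n M *ᵥ cplx v :=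
  (isReal_Lap n M).cplx_mulVec v

/-- **(1.115), member `|ΔGJ| ≤ O(1)|J|`, on real fields**: `|(ΔGB)(b)| ≤ C|B|`. [cite: Balaban1984PropagatorsI, (1.115) p.36] -/
theorem abs_LapR_G_le_of_global (hn : 1 ≤ n) (hC : 0 ≤ C)
    (hG : B5.Global115_117 (latticeSettingP12R n M a k) (gP12R M n a k) C Cα Cε Cαε) (B : VecR n M) (b : Bnd n M) :
    |(LapR n M *ᵥ (GR n M a *ᵥ B)) b| ≤ C * ‖B‖ := by
  have h : ‖(LapR n M *ᵥ (GR n M a *ᵥ B) : VecR n M)‖ ≤ C * ‖B‖ := by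
    refine norm_le_of_cubewise hn (mul_nonneg hC (norm_nonneg B)) fun y => ?_
    have h1 := hG.1 3 (LocR.vec B) y
    have h2 : (latticeSettingP12R n M a k).e 3 (LocR.vec B) y
        = supNorm (cubeB n M y) (Lap n M *ᵥ ((B5DeltaA169.DeltaA n M a)⁻¹ *ᵥ cplx B)) := rfl
    rw [h2, setting_supNorm_vec, ← cplx_GR_mulVec, ← cplx_LapR_mulVec] at h1
    exact h1
  exact (abs_le_norm _ b).trans h

/-- **(1.115), member `‖∇GJ‖_α ≤ O(1)|J|`, on real fields**: `‖∇GB‖_α ≤ C_α(α)|B|` (`0 ≤ α < 1`).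
[cite: Balaban1984PropagatorsI, (1.115) p.36, (1.109) p.35] -/
theorem holderT_gradR_G_le_of_global
    (hG : B5.Global115_117 (latticeSettingP12R n M a k) (gP12R M n a k) C Cα Cε Cαε) {α : ℝ} (hα0 : 0 ≤ α) (hα1 : α < 1)
    (B : VecR n M) : holderT n M α (fun ν => cplx (gradR n M (GR n M a *ᵥ B) ν)) ≤ Cα α * ‖B‖ := by
  have h1 := hG.2.1 α (LocR.vec B) hα0 hα1
  have h2 : (gP12R M n a k).hg1 (LocR.vec B) α
      = holderT n M α (grad n M ((B5DeltaA169.DeltaA n M a)⁻¹ *ᵥ cplx B)) := rfl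
  rw [h2, setting_supNorm_vec, ← cplx_GR_mulVec] at h1
  have e : grad n M (cplx (GR n M a *ᵥ B)) = fun ν => cplx (gradR n M (GR n M a *ᵥ B) ν) := by
    funext ν; rw [cplx_gradR]
  rw [e] at h1
  exact h1

/-- **(1.115), member `‖G∇*J‖_α ≤ O(1)|J|`, on real fields**: `‖G∇*T‖_α ≤ C_α(α)|T|` (`0 ≤ α < 1`).
[cite: Balaban1984PropagatorsI, (1.115) p.36, (1.109) p.35] -/
theorem holderV_G_divTR_le_of_global
    (hG : B5.Global115_117 (latticeSettingP12R n M a k) (gP12R M n a k) C Cα Cε Cαε) {α : ℝ} (hα0 : 0 ≤ α) (hα1 : α < 1)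
    (T : Fin d → VecR n M) : holderV n M α (cplx (GR n M a *ᵥ divTR n M T)) ≤ Cα α * ‖T‖ := by
  have h1 := hG.2.1 α (LocR.ten T) hα0 hα1
  have h2 : (gP12R M n a k).hg1 (LocR.ten T) α
      = holderV n M α ((B5DeltaA169.DeltaA n M a)⁻¹ *ᵥ divT n M fun ν => cplx (T ν)) := rfl
  rw [h2, setting_supNorm_ten, ← cplx_divTR, ← cplx_GR_mulVec] at h1
  exact h1

/-- **(1.116) on real fields**: `|∇G∇*T| ≤ C_ε(ε)(‖T‖_ε + |T|)` (`0 < ε < 1`). [cite: Balaban1984PropagatorsI, (1.116) p.36] -/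
theorem norm_gradR_G_divTR_le_of_global
    (hG : B5.Global115_117 (latticeSettingP12R n M a k) (gP12R M n a k) C Cα Cε Cαε) {ε : ℝ} (hε0 : 0 < ε) (hε1 : ε < 1)
    (T : Fin d → VecR n M) :
    ‖gradR n M (GR n M a *ᵥ divTR n M T)‖ ≤ Cε ε * (holderT n M ε (fun ν => cplx (T ν)) + ‖T‖) := by
  have h1 := hG.2.2.1 ε (LocR.ten T) hε0 hε1
  have h2 : (gP12R M n a k).e4g (LocR.ten T) = supNorm Finset.univ (fun p : Fin d × Bnd n M =>
      grad n M ((B5DeltaA169.DeltaA n M a)⁻¹ *ᵥ divT n M fun ν => cplx (T ν)) p.1 p.2) := rfl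
  have h3 : (latticeSettingP12R n M a k).holder ε (LocR.ten T) = holderT n M ε (fun ν => cplx (T ν)) := rfl
  rw [h2, h3, setting_supNorm_ten, ← cplx_divTR, ← cplx_GR_mulVec] at h1
  have e : (fun p : Fin d × Bnd n M => grad n M (cplx (GR n M a *ᵥ divTR n M T)) p.1 p.2)
      = fun p : Fin d × Bnd n M => cplx (gradR n M (GR n M a *ᵥ divTR n M T) p.1) p.2 := by
    funext p; rw [cplx_gradR]
  rw [e, supNorm_ten_cplx_eq] at h1
  exact h1

/-- **(1.117) on real fields**: `‖∇G∇*T‖_α ≤ C_{α,ε}(α,ε)(‖T‖_{α+ε} + |T|)` (`0 ≤ α`, `0 < ε`, `α + ε < 1`).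
[cite: Balaban1984PropagatorsI, (1.117) p.36] -/
theorem holderT_gradR_G_divTR_le_of_global
    (hG : B5.Global115_117 (latticeSettingP12R n M a k) (gP12R M n a k) C Cα Cε Cαε) {α ε : ℝ} (hα0 : 0 ≤ α) (hε0 : 0 < ε)
    (hαε : α + ε < 1) (T : Fin d → VecR n M) :
    holderT n M α (fun ν => cplx (gradR n M (GR n M a *ᵥ divTR n M T) ν))
      ≤ Cαε α ε * (holderT n M (α + ε) (fun ν => cplx (T ν)) + ‖T‖) := by
  have h1 := hG.2.2.2 α ε (LocR.ten T) hα0 hε0 hαε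
  have h2 : (gP12R M n a k).hg2 (LocR.ten T) α
      = holderT n M α (grad n M ((B5DeltaA169.DeltaA n M a)⁻¹ *ᵥ divT n M fun ν => cplx (T ν))) := rfl
  have h3 : (latticeSettingP12R n M a k).holder (α + ε) (LocR.ten T) = holderT n M (α + ε) (fun ν => cplx (T ν)) := rfl
  rw [h2, h3, setting_supNorm_ten, ← cplx_divTR, ← cplx_GR_mulVec] at h1
  have e : grad n M (cplx (GR n M a *ᵥ divTR n M T)) = fun ν => cplx (gradR n M (GR n M a *ᵥ divTR n M T) ν) := by
    funext ν; rw [cplx_gradR]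
  rw [e] at h1
  exact h1

end Readings

/-! ## §2 Generic pair estimates: products with `ζ`, with `h_z`, with `∇h_z` -/

section Pair

variable {n : ℕ} [NeZero n] {M : Fin d → ℕ} [hM : ∀ μ, NeZero (M μ)] {M₀ : ℕ}

/-- **pair estimate for a cut-off product**: if `|F(x′,μ) − F(x,μ)| ≤ Q·t^α` (`t = |x − x′| ∈ (0,1]`), then
`|ζ(x′)F(x′,μ) − ζ(x)F(x,μ)| ≤ (‖ζ‖_α·|F| + |ζ|·Q)·t^α` — the mechanism of the factor `(‖ζ‖_α + |ζ|)` in (1.125)/(1.130).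
[cite: Balaban1984PropagatorsI, (1.125) p.38, (1.109) p.35] -/
theorem pair_cut_le (α : ℝ) (ζ : Tor (fine n M) → ℝ) (F : VecR n M) {x x' : Tor (fine n M)} (μ : Fin d) {Q : ℝ}
    (h1 : distU n M x x' ≤ 1) (h0 : 0 < distU n M x x') (hQ : |F (x', μ) - F (x, μ)| ≤ Q * distU n M x x' ^ α) :
    |ζ x' * F (x', μ) - ζ x * F (x, μ)| ≤ (holS n M α ζ * ‖F‖ + cutSupL n M ζ * Q) * distU n M x x' ^ α := by
  have ht : 0 ≤ distU n M x x' ^ α := Real.rpow_nonneg h0.le α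
  have hζ := abs_sub_le_holS_mul α ζ h1 h0
  have hF : |F (x', μ)| ≤ ‖F‖ := abs_le_norm F _
  have hz : |ζ x| ≤ cutSupL n M ζ := abs_le_cutSupL ζ x
  calc |ζ x' * F (x', μ) - ζ x * F (x, μ)| ≤ |ζ x' - ζ x| * |F (x', μ)| + |ζ x| * |F (x', μ) - F (x, μ)| :=
        abs_mul_sub_mul_le _ _ _ _
    _ ≤ (holS n M α ζ * distU n M x x' ^ α) * ‖F‖ + cutSupL n M ζ * (Q * distU n M x x' ^ α) :=
        add_le_add (mul_le_mul hζ hF (abs_nonneg _) (mul_nonneg (holS_nonneg α ζ) ht))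
          (mul_le_mul hz hQ (abs_nonneg _) (cutSupL_nonneg' ζ))
    _ = (holS n M α ζ * ‖F‖ + cutSupL n M ζ * Q) * distU n M x x' ^ α := by ring

/-- **pair estimate for the product with the shifted multiplier `h_z(· + e_ν)`** (`|h_z| ≤ 1`, `(Lw/M₀)`-Lipschitz): if
`|F(x′,μ) − F(x,μ)| ≤ Q·t^α` then `|h_z(x′+e_ν)F(x′,μ) − h_z(x+e_ν)F(x,μ)| ≤ ((Lw/M₀)|F| + Q)·t^α` (`α ≤ 1`).
[cite: Balaban1984PropagatorsI, (1.125) p.38, (1.121) p.37] -/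
theorem pair_gz_nb_le (hn : 1 ≤ n) (hM₀ : 1 ≤ M₀) (z : Cen M M₀) (ν : Fin d) {α : ℝ} (hα : α ≤ 1) (F : VecR n M)
    {x x' : Tor (fine n M)} (μ : Fin d) {Q : ℝ} (h1 : distU n M x x' ≤ 1) (h0 : 0 < distU n M x x')
    (hQ : |F (x', μ) - F (x, μ)| ≤ Q * distU n M x x' ^ α) :
    |gz n M M₀ z (nb n M ν (x', μ)) * F (x', μ) - gz n M M₀ z (nb n M ν (x, μ)) * F (x, μ)|
      ≤ (Lw d / M₀ * ‖F‖ + Q) * distU n M x x' ^ α := by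
  have ht : 0 ≤ distU n M x x' ^ α := Real.rpow_nonneg h0.le α
  have htt : distU n M x x' ≤ distU n M x x' ^ α := le_rpow_self_of_le_one h0 h1 hα
  have hL : 0 ≤ Lw d / M₀ := div_nonneg (Lw_nonneg d) (Nat.cast_nonneg _)
  have hg : |gz n M M₀ z (nb n M ν (x', μ)) - gz n M M₀ z (nb n M ν (x, μ))| ≤ Lw d / M₀ * distU n M x x' ^ α := by
    refine (abs_gz_sub_le hn hM₀ z _ _).trans ?_
    rw [show (nb n M ν (x', μ)).1 = x' + unitVec (fine n M) ν from rfl,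
      show (nb n M ν (x, μ)).1 = x + unitVec (fine n M) ν from rfl, distU_add_right, distU_comm]
    exact mul_le_mul_of_nonneg_left htt hL
  have hg1 : |gz n M M₀ z (nb n M ν (x, μ))| ≤ 1 := abs_gz_le_one (n := n) z _
  have hF : |F (x', μ)| ≤ ‖F‖ := abs_le_norm F _
  calc |gz n M M₀ z (nb n M ν (x', μ)) * F (x', μ) - gz n M M₀ z (nb n M ν (x, μ)) * F (x, μ)|
      ≤ |gz n M M₀ z (nb n M ν (x', μ)) - gz n M M₀ z (nb n M ν (x, μ))| * |F (x', μ)|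
        + |gz n M M₀ z (nb n M ν (x, μ))| * |F (x', μ) - F (x, μ)| := abs_mul_sub_mul_le _ _ _ _
    _ ≤ (Lw d / M₀ * distU n M x x' ^ α) * ‖F‖ + 1 * (Q * distU n M x x' ^ α) :=
        add_le_add (mul_le_mul hg hF (abs_nonneg _) (mul_nonneg hL ht)) (mul_le_mul hg1 hQ (abs_nonneg _) zero_le_one)
    _ = (Lw d / M₀ * ‖F‖ + Q) * distU n M x x' ^ α := by ring

/-- **pair estimate for the product with `∇_νh_z`** (`|∇_νh_z| ≤ Lw/M₀`, `‖∇_νh_z‖_α ≤ dKmix/M₀²`): if `|F(x′,μ) − F(x,μ)| ≤ Q·t^α`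
then `|(∇_νh_z)(x′)F(x′,μ) − (∇_νh_z)(x)F(x,μ)| ≤ (dKmix/M₀²·|F| + (Lw/M₀)·Q)·t^α` (`α ≤ 1`).
[cite: Balaban1984PropagatorsI, (1.125) p.38, (1.121) p.37] -/
theorem pair_dgz_le (hn : 1 ≤ n) (hM₀ : 1 ≤ M₀) (z : Cen M M₀) (ν : Fin d) {α : ℝ} (hα : α ≤ 1) (F : VecR n M)
    {x x' : Tor (fine n M)} (μ : Fin d) {Q : ℝ} (h1 : distU n M x x' ≤ 1) (h0 : 0 < distU n M x x')
    (hQ : |F (x', μ) - F (x, μ)| ≤ Q * distU n M x x' ^ α) :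
    |dgz n M M₀ z ν (x', μ) * F (x', μ) - dgz n M M₀ z ν (x, μ) * F (x, μ)|
      ≤ (d * (Kmix / (M₀ : ℝ) ^ 2) * ‖F‖ + Lw d / M₀ * Q) * distU n M x x' ^ α := by
  have ht : 0 ≤ distU n M x x' ^ α := Real.rpow_nonneg h0.le α
  have hL : 0 ≤ Lw d / M₀ := div_nonneg (Lw_nonneg d) (Nat.cast_nonneg _)
  have hK : 0 ≤ d * (Kmix / (M₀ : ℝ) ^ 2) := by have := Kmix_nonneg; positivity
  have hd : |dgz n M M₀ z ν (x', μ) - dgz n M M₀ z ν (x, μ)| ≤ d * (Kmix / (M₀ : ℝ) ^ 2) * distU n M x x' ^ α :=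
    (abs_sub_le_holderV_mul α (dgz n M M₀ z ν) μ h1 h0).trans
      (mul_le_mul_of_nonneg_right (holderV_dgz_le hM₀ z ν hα) ht)
  have hd1 : |dgz n M M₀ z ν (x, μ)| ≤ Lw d / M₀ := abs_dgz_le hn hM₀ z ν _
  have hF : |F (x', μ)| ≤ ‖F‖ := abs_le_norm F _
  calc |dgz n M M₀ z ν (x', μ) * F (x', μ) - dgz n M M₀ z ν (x, μ) * F (x, μ)|
      ≤ |dgz n M M₀ z ν (x', μ) - dgz n M M₀ z ν (x, μ)| * |F (x', μ)| + |dgz n M M₀ z ν (x, μ)| * |F (x', μ) - F (x, μ)| :=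
        abs_mul_sub_mul_le _ _ _ _
    _ ≤ (d * (Kmix / (M₀ : ℝ) ^ 2) * distU n M x x' ^ α) * ‖F‖ + Lw d / M₀ * (Q * distU n M x x' ^ α) :=
        add_le_add (mul_le_mul hd hF (abs_nonneg _) (mul_nonneg hK ht)) (mul_le_mul hd1 hQ (abs_nonneg _) hL)
    _ = (d * (Kmix / (M₀ : ℝ) ^ 2) * ‖F‖ + Lw d / M₀ * Q) * distU n M x x' ^ α := by ring

/-- **pair estimate from the gradient**: `|F(x′,μ) − F(x,μ)| ≤ d|∇F|·t^α` (`α ≤ 1`, `t ≤ 1`; the lattice-path lemma).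
[cite: Balaban1984PropagatorsI, (1.108)–(1.109) p.35] -/
theorem pair_grad_le {α : ℝ} (hα : α ≤ 1) (F : VecR n M) {x x' : Tor (fine n M)} (μ : Fin d) (h1 : distU n M x x' ≤ 1)
    (h0 : 0 < distU n M x x') : |F (x', μ) - F (x, μ)| ≤ d * ‖gradR n M F‖ * distU n M x x' ^ α := by
  calc |F (x', μ) - F (x, μ)| ≤ d * distU n M x x' * ‖gradR n M F‖ := abs_sub_le_distU_mul F x x' μ
    _ ≤ d * distU n M x x' ^ α * ‖gradR n M F‖ := by
        gcongr; exact le_rpow_self_of_le_one h0 h1 hα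
    _ = d * ‖gradR n M F‖ * distU n M x x' ^ α := by ring

/-- **the Leibniz pair estimate for `∇_ν(h_zW)`**: `∇_ν(h_zW) = h_z(·+e_ν)∇_νW + (∇_νh_z)W`, so if `|(∇_νW)_μ(x′) − (∇_νW)_μ(x)| ≤ Q·t^α`
then `|(∇_ν(h_zW))_μ(x′) − (∇_ν(h_zW))_μ(x)| ≤ ((Lw/M₀)|∇W| + Q + dKmix/M₀²|W| + (Lw/M₀)d|∇W|)·t^α` (`α ≤ 1`).
[cite: Balaban1984PropagatorsI, (1.125) p.38, (1.121) p.37] -/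
theorem pair_gradR_gz_mul_le (hn : 1 ≤ n) (hM₀ : 1 ≤ M₀) (z : Cen M M₀) (ν : Fin d) {α : ℝ} (hα : α ≤ 1) (W : VecR n M)
    {x x' : Tor (fine n M)} (μ : Fin d) {Q : ℝ} (h1 : distU n M x x' ≤ 1) (h0 : 0 < distU n M x x')
    (hQ : |gradR n M W ν (x', μ) - gradR n M W ν (x, μ)| ≤ Q * distU n M x x' ^ α) :
    |gradR n M (fun b => gz n M M₀ z b * W b) ν (x', μ) - gradR n M (fun b => gz n M M₀ z b * W b) ν (x, μ)|
      ≤ (Lw d / M₀ * ‖gradR n M W‖ + Q + (d * (Kmix / (M₀ : ℝ) ^ 2) * ‖W‖ + Lw d / M₀ * (d * ‖gradR n M W‖)))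
        * distU n M x x' ^ α := by
  rw [gradR_mul_eq]
  simp only [Pi.add_apply]
  have hA := pair_gz_nb_le hn hM₀ z ν hα (gradR n M W ν) μ h1 h0 hQ
  have hB := pair_dgz_le hn hM₀ z ν hα W μ h1 h0 (pair_grad_le hα W μ h1 h0)
  have hWν : ‖gradR n M W ν‖ ≤ ‖gradR n M W‖ := norm_le_pi_norm _ ν
  have ht : 0 ≤ distU n M x x' ^ α := Real.rpow_nonneg h0.le α
  have hL : 0 ≤ Lw d / M₀ := div_nonneg (Lw_nonneg d) (Nat.cast_nonneg _)
  have e : ∀ b : Bnd n M, (n : ℝ) * (gz n M M₀ z (nb n M ν b) - gz n M M₀ z b) * W b = dgz n M M₀ z ν b * W b :=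
    fun b => rfl
  rw [e, e]
  calc |gz n M M₀ z (nb n M ν (x', μ)) * gradR n M W ν (x', μ) + dgz n M M₀ z ν (x', μ) * W (x', μ)
        - (gz n M M₀ z (nb n M ν (x, μ)) * gradR n M W ν (x, μ) + dgz n M M₀ z ν (x, μ) * W (x, μ))|
      = |(gz n M M₀ z (nb n M ν (x', μ)) * gradR n M W ν (x', μ) - gz n M M₀ z (nb n M ν (x, μ)) * gradR n M W ν (x, μ))
        + (dgz n M M₀ z ν (x', μ) * W (x', μ) - dgz n M M₀ z ν (x, μ) * W (x, μ))| := by ring_nf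
    _ ≤ |gz n M M₀ z (nb n M ν (x', μ)) * gradR n M W ν (x', μ) - gz n M M₀ z (nb n M ν (x, μ)) * gradR n M W ν (x, μ)|
        + |dgz n M M₀ z ν (x', μ) * W (x', μ) - dgz n M M₀ z ν (x, μ) * W (x, μ)| := abs_add_le _ _
    _ ≤ (Lw d / M₀ * ‖gradR n M W ν‖ + Q) * distU n M x x' ^ α
        + (d * (Kmix / (M₀ : ℝ) ^ 2) * ‖W‖ + Lw d / M₀ * (d * ‖gradR n M W‖)) * distU n M x x' ^ α := add_le_add hA hB
    _ ≤ (Lw d / M₀ * ‖gradR n M W‖ + Q) * distU n M x x' ^ α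
        + (d * (Kmix / (M₀ : ℝ) ^ 2) * ‖W‖ + Lw d / M₀ * (d * ‖gradR n M W‖)) * distU n M x x' ^ α := by
        have : Lw d / M₀ * ‖gradR n M W ν‖ ≤ Lw d / M₀ * ‖gradR n M W‖ := mul_le_mul_of_nonneg_left hWν hL
        nlinarith
    _ = _ := by ring

end Pair

/-! ## §3 (1.125): the first factor, for the four kinds of direct output functionals -/

section First

variable {n : ℕ} [NeZero n] {M : Fin d → ℕ} [hM : ∀ μ, NeZero (M μ)] {a : ℝ} {M₀ : ℕ} (k : ℕ)
  {C : ℝ} {Cα Cε : ℝ → ℝ} {Cαε : ℝ → ℝ → ℝ}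

/-- the constant of (1.125) for the `∇`-evaluation functional: `1 + Lw`. [cite: Balaban1984PropagatorsI, (1.125) p.38] -/
def cF1 (d : ℕ) : ℝ := 1 + Lw d

/-- the constant of (1.125) for the `Δ`-evaluation functional: `1 + 2dLw + dK2`. [cite: Balaban1984PropagatorsI, (1.125) p.38, (1.121) p.37] -/
def cF3 (d : ℕ) : ℝ := 1 + 2 * d * Lw d + d * K2

/-- the constant of (1.125) for the Hölder-quotient functional: `1 + 2Lw + dKmix + dLw`. [cite: Balaban1984PropagatorsI, (1.125) p.38] -/
def cFH (d : ℕ) : ℝ := 1 + 2 * Lw d + d * Kmix + d * Lw d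

omit hM in
/-- `1 ≤ cF1`. [cite: Balaban1984PropagatorsI, (1.125) p.38] -/
theorem one_le_cF1 : 1 ≤ cF1 d := by unfold cF1; have := Lw_nonneg d; linarith

omit hM in
/-- `1 ≤ cF3`. [cite: Balaban1984PropagatorsI, (1.125) p.38] -/
theorem one_le_cF3 : 1 ≤ cF3 d := by
  unfold cF3
  have h1 : 0 ≤ 2 * (d : ℝ) * Lw d := by have := Lw_nonneg d; positivity
  have h2 : 0 ≤ (d : ℝ) * K2 := by have := K2_nonneg; positivity
  linarith

omit hM in
/-- `1 ≤ cFH`. [cite: Balaban1984PropagatorsI, (1.125) p.38] -/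
theorem one_le_cFH : 1 ≤ cFH d := by
  unfold cFH
  have h1 : 0 ≤ Lw d := Lw_nonneg d
  have h2 : 0 ≤ (d : ℝ) * Kmix := by have := Kmix_nonneg; positivity
  have h3 : 0 ≤ (d : ℝ) * Lw d := by positivity
  linarith

/-- `K/M₀² ≤ K` for `K ≥ 0`, `M₀ ≥ 1`. [cite: Balaban1984PropagatorsI, (1.128) p.38 (O(M₀⁻¹))] -/
theorem div_sq_le (hM₀ : 1 ≤ M₀) {K : ℝ} (hK : 0 ≤ K) : K / (M₀ : ℝ) ^ 2 ≤ K := by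
  have h1 : (1 : ℝ) ≤ M₀ := by exact_mod_cast hM₀
  exact div_le_self hK (one_le_pow₀ h1)

omit hM in
/-- bookkeeping of the factor `(‖ζ‖_α + |ζ|)`: `S·f + Z·q ≤ X·(S + Z)` when `f, q ≤ X` (folklore). [cite: Balaban1984PropagatorsI, (1.125) p.38] -/
theorem combine_le {S Z f q X : ℝ} (hS : 0 ≤ S) (hZ : 0 ≤ Z) (hf : f ≤ X) (hq : q ≤ X) : S * f + Z * q ≤ X * (S + Z) := by
  have h1 := mul_le_mul_of_nonneg_left hf hS
  have h2 := mul_le_mul_of_nonneg_left hq hZ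
  nlinarith

omit [NeZero n] hM in
/-- `h_zv` as a field (pointwise `Hs z v`). [cite: Balaban1984PropagatorsI, (1.118) p.36] -/
theorem Hs_eq_fun (z : Cen M M₀) (v : VecR n M) :
    B5SupCarrierTorus.Hs n M M₀ z v = fun b => gz n M M₀ z b * v b := rfl

/-- **(1.125), evaluation functional (for `|GJ|` of (1.110))**: `|(h_zGB)(b)| ≤ C|B|`. [cite: Balaban1984PropagatorsI, (1.125) p.38, (1.115) p.36] -/
theorem abs_gz_G_le (hn : 1 ≤ n) (hC : 0 ≤ C)
    (hG : B5.Global115_117 (latticeSettingP12R n M a k) (gP12R M n a k) C Cα Cε Cαε) (z : Cen M M₀) (B : VecR n M)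
    (b : Bnd n M) : |gz n M M₀ z b * (GR n M a *ᵥ B) b| ≤ C * ‖B‖ := by
  have h1 := (abs_le_norm _ b).trans ((norm_Gs_le_of_global k hn hC hG B))
  rw [Gs_apply] at h1
  rw [abs_mul]
  have hg := abs_gz_le_one (n := n) z b
  have h0 := abs_nonneg ((GR n M a *ᵥ B) b)
  nlinarith

/-- **the remainder clause, evaluation functional**: `|(GB)(b)| ≤ C|B|`. [cite: Balaban1984PropagatorsI, (1.115) p.36] -/
theorem abs_G_le (hn : 1 ≤ n) (hC : 0 ≤ C)
    (hG : B5.Global115_117 (latticeSettingP12R n M a k) (gP12R M n a k) C Cα Cε Cαε) (B : VecR n M) (b : Bnd n M) :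
    |(GR n M a *ᵥ B) b| ≤ C * ‖B‖ := by
  have h1 := (abs_le_norm _ b).trans ((norm_Gs_le_of_global k hn hC hG B))
  rwa [Gs_apply] at h1

/-- **the remainder clause, `∇`-evaluation functional**: `|(∇_νGB)(b)| ≤ C|B|`. [cite: Balaban1984PropagatorsI, (1.115) p.36] -/
theorem abs_gradR_G_le (hn : 1 ≤ n) (hC : 0 ≤ C)
    (hG : B5.Global115_117 (latticeSettingP12R n M a k) (gP12R M n a k) C Cα Cε Cαε) (B : VecR n M) (ν : Fin d)
    (b : Bnd n M) : |gradR n M (GR n M a *ᵥ B) ν b| ≤ C * ‖B‖ := by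
  have h1 := norm_Dgs_Gs_le_of_global k hn hC hG B
  rw [Gs_apply] at h1
  exact (abs_le_norm_ten _ ν b).trans h1

/-- `‖∇GB‖ ≤ C|B|` on real fields. [cite: Balaban1984PropagatorsI, (1.115) p.36] -/
theorem norm_gradR_G_le (hn : 1 ≤ n) (hC : 0 ≤ C)
    (hG : B5.Global115_117 (latticeSettingP12R n M a k) (gP12R M n a k) C Cα Cε Cαε) (B : VecR n M) :
    ‖gradR n M (GR n M a *ᵥ B)‖ ≤ C * ‖B‖ := by
  have h1 := norm_Dgs_Gs_le_of_global k hn hC hG B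
  rwa [Gs_apply] at h1

/-- `‖GB‖ ≤ C|B|` on real fields. [cite: Balaban1984PropagatorsI, (1.115) p.36] -/
theorem norm_G_le (hn : 1 ≤ n) (hC : 0 ≤ C)
    (hG : B5.Global115_117 (latticeSettingP12R n M a k) (gP12R M n a k) C Cα Cε Cαε) (B : VecR n M) :
    ‖GR n M a *ᵥ B‖ ≤ C * ‖B‖ := by
  have h1 := norm_Gs_le_of_global k hn hC hG B
  rwa [Gs_apply] at h1

/-- **(1.125), `∇`-evaluation functional (for `|∇GJ|`, `|∇G∇*J|` of (1.110), (1.112))**: `|(∇_ν h_zGB)(b)| ≤ (1 + Lw)·C·|B|`.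
[cite: Balaban1984PropagatorsI, (1.125) p.38, (1.115) p.36, (1.121) p.37] -/
theorem abs_gradR_gz_G_le (hn : 1 ≤ n) (hM₀ : 1 ≤ M₀) (hC : 0 ≤ C)
    (hG : B5.Global115_117 (latticeSettingP12R n M a k) (gP12R M n a k) C Cα Cε Cαε) (z : Cen M M₀) (B : VecR n M)
    (ν : Fin d) (b : Bnd n M) :
    |gradR n M (fun b' => gz n M M₀ z b' * (GR n M a *ᵥ B) b') ν b| ≤ cF1 d * C * ‖B‖ := by
  refine (abs_le_norm_ten _ ν b).trans ((norm_gradR_gz_mul_le hn hM₀ z _).trans ?_)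
  have h1 := norm_gradR_G_le k hn hC hG B
  have h2 := norm_G_le k hn hC hG B
  have h3 := Lw_div_le (d := d) hM₀
  have hL : 0 ≤ Lw d / M₀ := div_nonneg (Lw_nonneg d) (Nat.cast_nonneg _)
  unfold cF1
  have : Lw d / M₀ * ‖GR n M a *ᵥ B‖ ≤ Lw d * (C * ‖B‖) :=
    mul_le_mul h3 h2 (norm_nonneg _) (Lw_nonneg d)
  nlinarith

/-- **(1.125), `Δ`-evaluation functional (for `|ΔGJ|` of (1.110))**: `|(Δ h_zGB)(b)| ≤ (1 + 2dLw + dK2)·C·|B|`.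
[cite: Balaban1984PropagatorsI, (1.125) p.38, (1.115) p.36, (1.121) p.37 («(Δh)A»)] -/
theorem abs_LapR_gz_G_le (hn : 1 ≤ n) (hM₀ : 1 ≤ M₀) (hC : 0 ≤ C)
    (hG : B5.Global115_117 (latticeSettingP12R n M a k) (gP12R M n a k) C Cα Cε Cαε) (z : Cen M M₀) (B : VecR n M)
    (b : Bnd n M) :
    |(LapR n M *ᵥ fun b' => gz n M M₀ z b' * (GR n M a *ᵥ B) b') b| ≤ cF3 d * C * ‖B‖ := by
  refine (abs_LapR_gz_mul_le hn hM₀ z _ b).trans ?_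
  have h0 := abs_LapR_G_le_of_global k hn hC hG B b
  have h1 := norm_gradR_G_le k hn hC hG B
  have h2 := norm_G_le k hn hC hG B
  have h3 := Lw_div_le (d := d) hM₀
  have h4 := div_sq_le hM₀ K2_nonneg
  have hL : 0 ≤ Lw d / M₀ := div_nonneg (Lw_nonneg d) (Nat.cast_nonneg _)
  have hK : 0 ≤ K2 / (M₀ : ℝ) ^ 2 := div_nonneg K2_nonneg (sq_nonneg _)
  have hd : (0 : ℝ) ≤ d := Nat.cast_nonneg d
  have e1 : 2 * d * (Lw d / M₀) * ‖gradR n M (GR n M a *ᵥ B)‖ ≤ 2 * d * Lw d * (C * ‖B‖) := by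
    have := mul_le_mul h3 h1 (norm_nonneg _) (Lw_nonneg d)
    nlinarith
  have e2 : d * (K2 / (M₀ : ℝ) ^ 2) * ‖GR n M a *ᵥ B‖ ≤ d * K2 * (C * ‖B‖) := by
    have := mul_le_mul h4 h2 (norm_nonneg _) K2_nonneg
    nlinarith
  unfold cF3
  nlinarith

/-- **(1.125) AS PRINTED, READ AT A PAIR — the Hölder-quotient functional of `ζ∇(·)` (for (1.111), (1.113))**: for
`0 ≤ α < 1`, a pair `0 < |x − x′| ≤ 1` and indices `ν, μ`,
`|ζ(x′)(∇_ν h_zGB)_μ(x′) − ζ(x)(∇_ν h_zGB)_μ(x)| ≤ cFH·(C + |C_α(α)|)·(‖ζ‖_α + |ζ|)·|B|·|x − x′|^α` — i.e.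
«‖ζ∇h_zGh_zA‖_α ≤ O(1)(‖ζ‖_α + |ζ|)|h_zA|» with `B = h_zA`. [cite: Balaban1984PropagatorsI, (1.125) p.38, (1.115) p.36] -/
theorem quotH_gz_G_le (hn : 1 ≤ n) (hM₀ : 1 ≤ M₀) (hC : 0 ≤ C)
    (hG : B5.Global115_117 (latticeSettingP12R n M a k) (gP12R M n a k) C Cα Cε Cαε) (z : Cen M M₀) (B : VecR n M)
    {α : ℝ} (hα0 : 0 ≤ α) (hα1 : α < 1) (ζ : Tor (fine n M) → ℝ) (ν μ : Fin d) {x x' : Tor (fine n M)}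
    (h1 : distU n M x x' ≤ 1) (h0 : 0 < distU n M x x') :
    |ζ x' * gradR n M (fun b' => gz n M M₀ z b' * (GR n M a *ᵥ B) b') ν (x', μ)
        - ζ x * gradR n M (fun b' => gz n M M₀ z b' * (GR n M a *ᵥ B) b') ν (x, μ)|
      ≤ cFH d * (C + |Cα α|) * (holS n M α ζ + cutSupL n M ζ) * ‖B‖ * distU n M x x' ^ α := by
  set W : VecR n M := GR n M a *ᵥ B with hW
  have ht : 0 ≤ distU n M x x' ^ α := Real.rpow_nonneg h0.le α
  -- the Hölder datum of `∇W` at the pair, from (1.115): `‖∇GB‖_α ≤ C_α(α)|B|`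
  have hQ : |gradR n M W ν (x', μ) - gradR n M W ν (x, μ)| ≤ |Cα α| * ‖B‖ * distU n M x x' ^ α := by
    refine (abs_sub_le_holderT_mul α (gradR n M W) ν μ h1 h0).trans (mul_le_mul_of_nonneg_right ?_ ht)
    exact (holderT_gradR_G_le_of_global k hG hα0 hα1 B).trans
      (mul_le_mul_of_nonneg_right (le_abs_self _) (norm_nonneg B))
  have hP := pair_gradR_gz_mul_le hn hM₀ z ν hα1.le W μ h1 h0 hQ
  set F : VecR n M := gradR n M (fun b => gz n M M₀ z b * W b) ν with hF
  have hF1 : ∀ y : Tor (fine n M), F (y, μ) = gradR n M (fun b => gz n M M₀ z b * W b) ν (y, μ) := fun y => rfl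
  have hcut := pair_cut_le α ζ F μ h1 h0 (by rw [hF1, hF1]; exact hP)
  rw [hF1, hF1] at hcut
  refine hcut.trans (mul_le_mul_of_nonneg_right ?_ ht)
  -- sizes
  have hgW := norm_gradR_G_le k hn hC hG B
  have hW0 := norm_G_le k hn hC hG B
  rw [← hW] at hgW hW0
  have hFn : ‖F‖ ≤ (1 + Lw d) * (C * ‖B‖) := by
    refine (norm_le_pi_norm _ ν).trans ((norm_gradR_gz_mul_le hn hM₀ z W).trans ?_)
    have h3 := Lw_div_le (d := d) hM₀
    have := mul_le_mul h3 hW0 (norm_nonneg _) (Lw_nonneg d)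
    nlinarith
  have hL : 0 ≤ Lw d / M₀ := div_nonneg (Lw_nonneg d) (Nat.cast_nonneg _)
  have h3 := Lw_div_le (d := d) hM₀
  have h4 := div_sq_le hM₀ Kmix_nonneg
  have hd : (0 : ℝ) ≤ d := Nat.cast_nonneg d
  have hLw := Lw_nonneg d
  have hKm := Kmix_nonneg
  have hB := norm_nonneg B
  have hCa := abs_nonneg (Cα α)
  have hS := holS_nonneg (n := n) (M := M) α ζ
  have hZ := cutSupL_nonneg' (n := n) (M := M) ζ
  -- the quotient datum of `F`
  have hQ' : Lw d / M₀ * ‖gradR n M W‖ + |Cα α| * ‖B‖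
        + (d * (Kmix / (M₀ : ℝ) ^ 2) * ‖W‖ + Lw d / M₀ * (d * ‖gradR n M W‖))
      ≤ (Lw d + d * Kmix + d * Lw d) * (C * ‖B‖) + |Cα α| * ‖B‖ := by
    have e1 : Lw d / M₀ * ‖gradR n M W‖ ≤ Lw d * (C * ‖B‖) := mul_le_mul h3 hgW (norm_nonneg _) hLw
    have e2 : d * (Kmix / (M₀ : ℝ) ^ 2) * ‖W‖ ≤ d * Kmix * (C * ‖B‖) := by
      have := mul_le_mul h4 hW0 (norm_nonneg _) hKm
      nlinarith
    have e3 : Lw d / M₀ * (d * ‖gradR n M W‖) ≤ Lw d * (d * (C * ‖B‖)) :=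
      mul_le_mul h3 (mul_le_mul_of_nonneg_left hgW hd) (by positivity) hLw
    nlinarith
  -- both sizes are `≤ X := cFH·(C + |C_α|)·|B|`
  have hcF : 0 ≤ cFH d := le_trans zero_le_one one_le_cFH
  have hCX : 0 ≤ C + |Cα α| := by positivity
  have hX1 : (1 + Lw d) * (C * ‖B‖) ≤ cFH d * (C + |Cα α|) * ‖B‖ := by
    have ha : 1 + Lw d ≤ cFH d := by
      unfold cFH
      have : 0 ≤ (d : ℝ) * Kmix := mul_nonneg hd hKm
      have : 0 ≤ (d : ℝ) * Lw d := mul_nonneg hd hLw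
      linarith
    have hb : C * ‖B‖ ≤ (C + |Cα α|) * ‖B‖ := mul_le_mul_of_nonneg_right (le_add_of_nonneg_right hCa) hB
    calc (1 + Lw d) * (C * ‖B‖) ≤ cFH d * ((C + |Cα α|) * ‖B‖) := mul_le_mul ha hb (by positivity) hcF
      _ = cFH d * (C + |Cα α|) * ‖B‖ := by ring
  have hX2 : (Lw d + d * Kmix + d * Lw d) * (C * ‖B‖) + |Cα α| * ‖B‖ ≤ cFH d * (C + |Cα α|) * ‖B‖ := by
    have ha : Lw d + d * Kmix + d * Lw d ≤ cFH d := by unfold cFH; linarith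
    have h1' : (Lw d + d * Kmix + d * Lw d) * (C * ‖B‖) ≤ cFH d * (C * ‖B‖) :=
      mul_le_mul_of_nonneg_right ha (by positivity)
    have h2' : |Cα α| * ‖B‖ ≤ cFH d * (|Cα α| * ‖B‖) :=
      le_mul_of_one_le_left (mul_nonneg hCa hB) one_le_cFH
    calc (Lw d + d * Kmix + d * Lw d) * (C * ‖B‖) + |Cα α| * ‖B‖
        ≤ cFH d * (C * ‖B‖) + cFH d * (|Cα α| * ‖B‖) := add_le_add h1' h2'
      _ = cFH d * (C + |Cα α|) * ‖B‖ := by ring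
  have key := combine_le hS hZ (hFn.trans hX1) (hQ'.trans hX2)
  linarith [key]

/-- **the remainder clause, Hölder-quotient functional**: `|ζ(x′)(∇_νGB)_μ(x′) − ζ(x)(∇_νGB)_μ(x)| ≤ (C + |C_α(α)|)(‖ζ‖_α + |ζ|)|B|·|x−x′|^α`.
[cite: Balaban1984PropagatorsI, (1.125) p.38, (1.115) p.36] -/
theorem quotH_G_le (hn : 1 ≤ n) (hC : 0 ≤ C)
    (hG : B5.Global115_117 (latticeSettingP12R n M a k) (gP12R M n a k) C Cα Cε Cαε) (B : VecR n M)
    {α : ℝ} (hα0 : 0 ≤ α) (hα1 : α < 1) (ζ : Tor (fine n M) → ℝ) (ν μ : Fin d) {x x' : Tor (fine n M)}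
    (h1 : distU n M x x' ≤ 1) (h0 : 0 < distU n M x x') :
    |ζ x' * gradR n M (GR n M a *ᵥ B) ν (x', μ) - ζ x * gradR n M (GR n M a *ᵥ B) ν (x, μ)|
      ≤ (C + |Cα α|) * (holS n M α ζ + cutSupL n M ζ) * ‖B‖ * distU n M x x' ^ α := by
  set W : VecR n M := GR n M a *ᵥ B with hW
  have ht : 0 ≤ distU n M x x' ^ α := Real.rpow_nonneg h0.le α
  have hQ : |gradR n M W ν (x', μ) - gradR n M W ν (x, μ)| ≤ |Cα α| * ‖B‖ * distU n M x x' ^ α := by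
    refine (abs_sub_le_holderT_mul α (gradR n M W) ν μ h1 h0).trans (mul_le_mul_of_nonneg_right ?_ ht)
    exact (holderT_gradR_G_le_of_global k hG hα0 hα1 B).trans
      (mul_le_mul_of_nonneg_right (le_abs_self _) (norm_nonneg B))
  have hcut := pair_cut_le α ζ (gradR n M W ν) μ h1 h0 hQ
  refine hcut.trans (mul_le_mul_of_nonneg_right ?_ ht)
  have hgW := norm_gradR_G_le k hn hC hG B
  rw [← hW] at hgW
  have hFn : ‖gradR n M W ν‖ ≤ C * ‖B‖ := (norm_le_pi_norm _ ν).trans hgW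
  have hB := norm_nonneg B
  have hCa := abs_nonneg (Cα α)
  have hS := holS_nonneg (n := n) (M := M) α ζ
  have hZ := cutSupL_nonneg' (n := n) (M := M) ζ
  have hX1 : C * ‖B‖ ≤ (C + |Cα α|) * ‖B‖ := by nlinarith
  have hX2 : |Cα α| * ‖B‖ ≤ (C + |Cα α|) * ‖B‖ := by nlinarith
  have key := combine_le hS hZ (hFn.trans hX1) hX2
  linarith [key]

end First

/-! ## §4 (1.129): the last factor, direct sources `J` and `∇*T` -/

section Last

variable {n : ℕ} [NeZero n] {M : Fin d → ℕ} [hM : ∀ μ, NeZero (M μ)] {a : ℝ} {M₀ : ℕ} (k : ℕ)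
  {C : ℝ} {Cα Cε : ℝ → ℝ} {Cαε : ℝ → ℝ → ℝ}

/-- the constant of (1.129) for the tensor source: `2 + 2dLw + Lw`. [cite: Balaban1984PropagatorsI, (1.129) p.38] -/
def cLT (d : ℕ) : ℝ := 2 + 2 * d * Lw d + Lw d

omit hM in
/-- `1 ≤ cLT`. [cite: Balaban1984PropagatorsI, (1.129) p.38] -/
theorem one_le_cLT : 1 ≤ cLT d := by
  unfold cLT
  have h1 : 0 ≤ Lw d := Lw_nonneg d
  have h3 : 0 ≤ 2 * (d : ℝ) * Lw d := by positivity
  linarith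

/-- **(1.129), VECTOR SOURCE**: `|∇Gh_zJ| + |Gh_zJ| ≤ 2C|J|` («The factors with G are estimated by using (1.115)»).
[cite: Balaban1984PropagatorsI, (1.129) p.38, (1.115) p.36] -/
theorem last_vec_le (hn : 1 ≤ n) (hC : 0 ≤ C)
    (hG : B5.Global115_117 (latticeSettingP12R n M a k) (gP12R M n a k) C Cα Cε Cαε) (z : Cen M M₀) (J : VecR n M) :
    ‖gradR n M (GR n M a *ᵥ fun b => gz n M M₀ z b * J b)‖ + ‖GR n M a *ᵥ fun b => gz n M M₀ z b * J b‖
      ≤ 2 * C * ‖J‖ := by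
  have hJ := norm_gz_mul_le z J
  have h1 := (norm_gradR_G_le k hn hC hG (fun b => gz n M M₀ z b * J b)).trans (mul_le_mul_of_nonneg_left hJ hC)
  have h2 := (norm_G_le k hn hC hG (fun b => gz n M M₀ z b * J b)).trans (mul_le_mul_of_nonneg_left hJ hC)
  linarith

/-- the multiplier decomposition of the source `h_z∇*T = ∇*(h_zT) + E_zT`. [cite: Balaban1984PropagatorsI, (1.121) p.37, p.39] -/
theorem gz_divTR_eq (z : Cen M M₀) (T : Fin d → VecR n M) :
    (fun b => gz n M M₀ z b * divTR n M T b) = divTR n M (fun ν b => gz n M M₀ z b * T ν b) + Ediv (gz n M M₀ z) T :=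
  mul_divTR_eq (gz n M M₀ z) T

/-- `|h_zT| ≤ |T|` for tensor fields. [cite: Balaban1984PropagatorsI, (1.118) p.36] -/
theorem norm_gz_mul_ten_le (z : Cen M M₀) (T : Fin d → VecR n M) :
    ‖(fun ν b => gz n M M₀ z b * T ν b : Fin d → VecR n M)‖ ≤ ‖T‖ :=
  (pi_norm_le_iff_of_nonneg (norm_nonneg T)).mpr fun ν => (norm_gz_mul_le z (T ν)).trans (norm_le_pi_norm T ν)

/-- **(1.129), TENSOR SOURCE, the `G` member**: `|Gh_z∇*T| ≤ (1 + dLw)C|T|` (via `|G∇*(h_zT)| ≤ C|T|` and `|G E_zT| ≤ C·dLw/M₀|T|`).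
[cite: Balaban1984PropagatorsI, (1.129) p.38, (1.115) p.36] -/
theorem norm_G_gz_divTR_le (hn : 1 ≤ n) (hM₀ : 1 ≤ M₀) (hC : 0 ≤ C)
    (hG : B5.Global115_117 (latticeSettingP12R n M a k) (gP12R M n a k) C Cα Cε Cαε) (z : Cen M M₀)
    (T : Fin d → VecR n M) :
    ‖GR n M a *ᵥ fun b => gz n M M₀ z b * divTR n M T b‖ ≤ (1 + d * Lw d) * C * ‖T‖ := by
  rw [gz_divTR_eq, Matrix.mulVec_add]
  refine (norm_add_le _ _).trans ?_
  have h1 := (norm_Gs_divTR_le_of_global k hn hC hG (fun ν b => gz n M M₀ z b * T ν b)).trans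
    (mul_le_mul_of_nonneg_left (norm_gz_mul_ten_le z T) hC)
  rw [Gs_apply] at h1
  have h2 := (norm_G_le k hn hC hG (Ediv (gz n M M₀ z) T)).trans
    (mul_le_mul_of_nonneg_left (norm_Ediv_le hn hM₀ z T) hC)
  have h3 := Lw_div_le (d := d) hM₀
  have hd : (0 : ℝ) ≤ d := Nat.cast_nonneg d
  have : C * (d * (Lw d / M₀) * ‖T‖) ≤ C * (d * Lw d * ‖T‖) := by
    refine mul_le_mul_of_nonneg_left ?_ hC
    exact mul_le_mul_of_nonneg_right (mul_le_mul_of_nonneg_left h3 hd) (norm_nonneg T)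
  nlinarith

/-- **(1.129), TENSOR SOURCE, the `∇G` member**: `|∇Gh_z∇*T| ≤ (|C_ε(ε)|(1 + Lw) + C·dLw)(‖T‖_ε + |T|)`, from (1.116) for `h_zT`
(`‖h_zT‖_ε ≤ ‖T‖_ε + (Lw/M₀)|T|`) and (1.115) for `E_zT`. [cite: Balaban1984PropagatorsI, (1.129) p.38, (1.116), (1.115) p.36] -/
theorem norm_gradR_G_gz_divTR_le (hn : 1 ≤ n) (hM₀ : 1 ≤ M₀) (hC : 0 ≤ C)
    (hG : B5.Global115_117 (latticeSettingP12R n M a k) (gP12R M n a k) C Cα Cε Cαε) (z : Cen M M₀)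
    (T : Fin d → VecR n M) {ε : ℝ} (hε0 : 0 < ε) (hε1 : ε < 1) :
    ‖gradR n M (GR n M a *ᵥ fun b => gz n M M₀ z b * divTR n M T b)‖
      ≤ (|Cε ε| * (1 + Lw d) + C * (d * Lw d)) * (holderT n M ε (fun ν => cplx (T ν)) + ‖T‖) := by
  rw [gz_divTR_eq, Matrix.mulVec_add, gradR_add]
  refine (norm_add_le _ _).trans ?_
  set N := holderT n M ε (fun ν => cplx (T ν)) + ‖T‖ with hN
  have hT0 := norm_nonneg T
  have hH0 : 0 ≤ holderT n M ε (fun ν => cplx (T ν)) := by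
    unfold holderT holderSeminormB5; exact LatticeNorms.holderSeminorm_nonneg _ _ _ _ _ _
  -- (1.116) for `h_zT`
  have h1 := norm_gradR_G_divTR_le_of_global k hG hε0 hε1 (fun ν b => gz n M M₀ z b * T ν b)
  have h1' : holderT n M ε (fun ν => cplx fun b => gz n M M₀ z b * T ν b) + ‖(fun ν b => gz n M M₀ z b * T ν b : Fin d → VecR n M)‖
      ≤ (1 + Lw d) * N := by
    have ha := holderT_gz_mul_le hn hM₀ z T hε1.le
    have hb := norm_gz_mul_ten_le z T
    have h3 := Lw_div_le (d := d) hM₀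
    have : Lw d / M₀ * ‖T‖ ≤ Lw d * ‖T‖ := mul_le_mul_of_nonneg_right h3 hT0
    have hLw := Lw_nonneg d
    nlinarith
  have hA : ‖gradR n M (GR n M a *ᵥ divTR n M fun ν b => gz n M M₀ z b * T ν b)‖ ≤ |Cε ε| * ((1 + Lw d) * N) := by
    refine h1.trans ?_
    have hpos : 0 ≤ holderT n M ε (fun ν => cplx fun b => gz n M M₀ z b * T ν b)
        + ‖(fun ν b => gz n M M₀ z b * T ν b : Fin d → VecR n M)‖ := by
      refine add_nonneg ?_ (norm_nonneg _)
      unfold holderT holderSeminormB5; exact LatticeNorms.holderSeminorm_nonneg _ _ _ _ _ _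
    calc Cε ε * _ ≤ |Cε ε| * _ := mul_le_mul_of_nonneg_right (le_abs_self _) hpos
      _ ≤ |Cε ε| * ((1 + Lw d) * N) := mul_le_mul_of_nonneg_left h1' (abs_nonneg _)
  -- (1.115) for `E_zT`
  have hB : ‖gradR n M (GR n M a *ᵥ Ediv (gz n M M₀ z) T)‖ ≤ C * (d * Lw d) * N := by
    refine (norm_gradR_G_le k hn hC hG _).trans ?_
    have hE := norm_Ediv_le hn hM₀ z T
    have h3 := Lw_div_le (d := d) hM₀
    have hd : (0 : ℝ) ≤ d := Nat.cast_nonneg d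
    have : d * (Lw d / M₀) * ‖T‖ ≤ d * Lw d * N := by
      have := mul_le_mul_of_nonneg_left h3 hd
      have hTN : ‖T‖ ≤ N := by rw [hN]; linarith
      exact mul_le_mul this hTN hT0 (mul_nonneg hd (Lw_nonneg d))
    nlinarith
  nlinarith

/-- **(1.129) FOR THE TENSOR SOURCE**: `|∇Gh_z∇*T| + |Gh_z∇*T| ≤ cLT·(C + |C_ε(ε)|)·(‖T‖_ε + |T|)`, `0 < ε < 1`.
[cite: Balaban1984PropagatorsI, (1.129) p.38, (1.115)–(1.116) p.36] -/
theorem last_ten_le (hn : 1 ≤ n) (hM₀ : 1 ≤ M₀) (hC : 0 ≤ C)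
    (hG : B5.Global115_117 (latticeSettingP12R n M a k) (gP12R M n a k) C Cα Cε Cαε) (z : Cen M M₀)
    (T : Fin d → VecR n M) {ε : ℝ} (hε0 : 0 < ε) (hε1 : ε < 1) :
    ‖gradR n M (GR n M a *ᵥ fun b => gz n M M₀ z b * divTR n M T b)‖ + ‖GR n M a *ᵥ fun b => gz n M M₀ z b * divTR n M T b‖
      ≤ cLT d * (C + |Cε ε|) * (holderT n M ε (fun ν => cplx (T ν)) + ‖T‖) := by
  have h1 := norm_gradR_G_gz_divTR_le k hn hM₀ hC hG z T hε0 hε1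
  have h2 := norm_G_gz_divTR_le k hn hM₀ hC hG z T
  have hT0 := norm_nonneg T
  have hH0 : 0 ≤ holderT n M ε (fun ν => cplx (T ν)) := by
    unfold holderT holderSeminormB5; exact LatticeNorms.holderSeminorm_nonneg _ _ _ _ _ _
  have hLw := Lw_nonneg d
  have hd : (0 : ℝ) ≤ d := Nat.cast_nonneg d
  have hCe := abs_nonneg (Cε ε)
  set N := holderT n M ε (fun ν => cplx (T ν)) + ‖T‖ with hN
  have hN0 : 0 ≤ N := add_nonneg hH0 hT0
  have hTN : ‖T‖ ≤ N := by rw [hN]; linarith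
  have h2' : ‖GR n M a *ᵥ fun b => gz n M M₀ z b * divTR n M T b‖ ≤ (1 + d * Lw d) * C * N :=
    h2.trans (mul_le_mul_of_nonneg_left hTN (by positivity))
  have e1 : |Cε ε| * (1 + Lw d) ≤ |Cε ε| * cLT d :=
    mul_le_mul_of_nonneg_left (by unfold cLT; nlinarith) hCe
  have e2 : C * (d * Lw d) + (1 + d * Lw d) * C ≤ C * cLT d := by
    have : d * Lw d + (1 + d * Lw d) ≤ cLT d := by unfold cLT; nlinarith
    nlinarith
  have e3 : (|Cε ε| * (1 + Lw d) + C * (d * Lw d)) * N + (1 + d * Lw d) * C * N ≤ cLT d * (C + |Cε ε|) * N := by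
    have := add_le_add (mul_le_mul_of_nonneg_right e1 hN0) (mul_le_mul_of_nonneg_right e2 hN0)
    nlinarith
  linarith

/-- **the second inequality of (1.129)**: `‖T‖_ε + |T| ≤ ‖T‖_{α+ε} + |T|` for `α ≥ 0` (monotonicity in the exponent on the pairs
`|x − x′| ≤ 1`). [cite: Balaban1984PropagatorsI, (1.129) p.38] -/
theorem holderT_add_norm_mono (T : Fin d → VecR n M) {ε α : ℝ} (hα : 0 ≤ α) :
    holderT n M ε (fun ν => cplx (T ν)) + ‖T‖ ≤ holderT n M (α + ε) (fun ν => cplx (T ν)) + ‖T‖ := by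
  have h := holderL_mono (n := n) (M := M) (LocR.ten T) (show ε ≤ α + ε by linarith)
  exact add_le_add h le_rfl

end Last

/-! ## §5 (1.130): the one-factor terms `D(h_zGh_z·src)` -/

section One

variable {n : ℕ} [NeZero n] {M : Fin d → ℕ} [hM : ∀ μ, NeZero (M μ)] {a : ℝ} {M₀ : ℕ} (k : ℕ)
  {C : ℝ} {Cα Cε : ℝ → ℝ} {Cαε : ℝ → ℝ → ℝ}

/-- the constant of (1.130) for the Hölder-quotient functional and the tensor source: `cFH·cLT + (1 + Lw + dLw)`.
[cite: Balaban1984PropagatorsI, (1.130) p.38] -/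
def c1H (d : ℕ) : ℝ := cFH d * cLT d + (1 + Lw d + d * Lw d)

omit hM in
/-- `1 ≤ c1H`. [cite: Balaban1984PropagatorsI, (1.130) p.38] -/
theorem one_le_c1H : 1 ≤ c1H d := by
  unfold c1H
  have h1 := one_le_cFH (d := d)
  have h2 := one_le_cLT (d := d)
  have h3 : 0 ≤ Lw d := Lw_nonneg d
  have h4 : 0 ≤ (d : ℝ) * Lw d := by positivity
  have h5 := one_le_mul_of_one_le_of_one_le h1 h2
  linarith

/-- **(1.130), vector source, evaluation functional**: `|(h_zGh_zJ)(b)| ≤ C|J|`. [cite: Balaban1984PropagatorsI, (1.130) p.38, (1.115) p.36] -/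
theorem one_eval_vec_le (hn : 1 ≤ n) (hC : 0 ≤ C)
    (hG : B5.Global115_117 (latticeSettingP12R n M a k) (gP12R M n a k) C Cα Cε Cαε) (z : Cen M M₀) (J : VecR n M)
    (b : Bnd n M) :
    |gz n M M₀ z b * (GR n M a *ᵥ fun b' => gz n M M₀ z b' * J b') b| ≤ C * ‖J‖ :=
  (abs_gz_G_le k hn hC hG z _ b).trans (mul_le_mul_of_nonneg_left (norm_gz_mul_le z J) hC)

/-- **(1.130), vector source, `∇`-evaluation functional**: `|(∇_ν h_zGh_zJ)(b)| ≤ cF1·C·|J|`. [cite: Balaban1984PropagatorsI, (1.130) p.38, (1.115) p.36] -/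
theorem one_grad_vec_le (hn : 1 ≤ n) (hM₀ : 1 ≤ M₀) (hC : 0 ≤ C)
    (hG : B5.Global115_117 (latticeSettingP12R n M a k) (gP12R M n a k) C Cα Cε Cαε) (z : Cen M M₀) (J : VecR n M)
    (ν : Fin d) (b : Bnd n M) :
    |gradR n M (fun b' => gz n M M₀ z b' * (GR n M a *ᵥ fun b'' => gz n M M₀ z b'' * J b'') b') ν b| ≤ cF1 d * C * ‖J‖ := by
  refine (abs_gradR_gz_G_le k hn hM₀ hC hG z _ ν b).trans ?_
  have h0 : 0 ≤ cF1 d * C := mul_nonneg (le_trans zero_le_one one_le_cF1) hC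
  exact mul_le_mul_of_nonneg_left (norm_gz_mul_le z J) h0

/-- **(1.130), vector source, `Δ`-evaluation functional**: `|(Δ h_zGh_zJ)(b)| ≤ cF3·C·|J|`. [cite: Balaban1984PropagatorsI, (1.130) p.38, (1.115) p.36] -/
theorem one_Lap_vec_le (hn : 1 ≤ n) (hM₀ : 1 ≤ M₀) (hC : 0 ≤ C)
    (hG : B5.Global115_117 (latticeSettingP12R n M a k) (gP12R M n a k) C Cα Cε Cαε) (z : Cen M M₀) (J : VecR n M)
    (b : Bnd n M) :
    |(LapR n M *ᵥ fun b' => gz n M M₀ z b' * (GR n M a *ᵥ fun b'' => gz n M M₀ z b'' * J b'') b') b| ≤ cF3 d * C * ‖J‖ := by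
  refine (abs_LapR_gz_G_le k hn hM₀ hC hG z _ b).trans ?_
  have h0 : 0 ≤ cF3 d * C := mul_nonneg (le_trans zero_le_one one_le_cF3) hC
  exact mul_le_mul_of_nonneg_left (norm_gz_mul_le z J) h0

/-- **(1.130), vector source, Hölder-quotient functional** («‖ζ∇h_zGh_zA‖_α ≤ O(1)(‖ζ‖_α + |ζ|)|h_zA|» with `|h_zA| ≤ |A|`):
`≤ cFH·(C + |C_α(α)|)·(‖ζ‖_α + |ζ|)·|J|·|x−x′|^α`. [cite: Balaban1984PropagatorsI, (1.130), (1.125) p.38] -/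
theorem one_quotH_vec_le (hn : 1 ≤ n) (hM₀ : 1 ≤ M₀) (hC : 0 ≤ C)
    (hG : B5.Global115_117 (latticeSettingP12R n M a k) (gP12R M n a k) C Cα Cε Cαε) (z : Cen M M₀) (J : VecR n M)
    {α : ℝ} (hα0 : 0 ≤ α) (hα1 : α < 1) (ζ : Tor (fine n M) → ℝ) (ν μ : Fin d) {x x' : Tor (fine n M)}
    (h1 : distU n M x x' ≤ 1) (h0 : 0 < distU n M x x') :
    |ζ x' * gradR n M (fun b' => gz n M M₀ z b' * (GR n M a *ᵥ fun b'' => gz n M M₀ z b'' * J b'') b') ν (x', μ)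
        - ζ x * gradR n M (fun b' => gz n M M₀ z b' * (GR n M a *ᵥ fun b'' => gz n M M₀ z b'' * J b'') b') ν (x, μ)|
      ≤ cFH d * (C + |Cα α|) * (holS n M α ζ + cutSupL n M ζ) * ‖J‖ * distU n M x x' ^ α := by
  refine (quotH_gz_G_le k hn hM₀ hC hG z _ hα0 hα1 ζ ν μ h1 h0).trans ?_
  have ht : 0 ≤ distU n M x x' ^ α := Real.rpow_nonneg h0.le α
  have h0' : 0 ≤ cFH d * (C + |Cα α|) * (holS n M α ζ + cutSupL n M ζ) := by
    have := one_le_cFH (d := d); have := abs_nonneg (Cα α); have := holS_nonneg (n := n) (M := M) α ζ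
    have := cutSupL_nonneg' (n := n) (M := M) ζ
    positivity
  exact mul_le_mul_of_nonneg_right (mul_le_mul_of_nonneg_left (norm_gz_mul_le z J) h0') ht

/-- **(1.130), tensor source, `∇`-evaluation functional (for (1.112))**: `|(∇_ν h_zGh_z∇*T)(b)| ≤ cF1·cLT·(C + |C_ε(ε)|)·(‖T‖_ε + |T|)`.
[cite: Balaban1984PropagatorsI, (1.130), (1.129) p.38, (1.116) p.36] -/
theorem one_grad_ten_le (hn : 1 ≤ n) (hM₀ : 1 ≤ M₀) (hC : 0 ≤ C)
    (hG : B5.Global115_117 (latticeSettingP12R n M a k) (gP12R M n a k) C Cα Cε Cαε) (z : Cen M M₀)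
    (T : Fin d → VecR n M) {ε : ℝ} (hε0 : 0 < ε) (hε1 : ε < 1) (ν : Fin d) (b : Bnd n M) :
    |gradR n M (fun b' => gz n M M₀ z b' * (GR n M a *ᵥ fun b'' => gz n M M₀ z b'' * divTR n M T b'') b') ν b|
      ≤ cF1 d * (cLT d * (C + |Cε ε|) * (holderT n M ε (fun ν => cplx (T ν)) + ‖T‖)) := by
  set W : VecR n M := GR n M a *ᵥ fun b'' => gz n M M₀ z b'' * divTR n M T b'' with hW
  have hL := last_ten_le k hn hM₀ hC hG z T hε0 hε1
  rw [← hW] at hL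
  refine (abs_le_norm_ten _ ν b).trans ((norm_gradR_gz_mul_le hn hM₀ z W).trans ?_)
  have h3 := Lw_div_le (d := d) hM₀
  have hW0 := norm_nonneg W
  have hgW0 := norm_nonneg (gradR n M W)
  have hLw := Lw_nonneg d
  have e1 : Lw d / M₀ * ‖W‖ ≤ Lw d * ‖W‖ := mul_le_mul_of_nonneg_right h3 hW0
  have e2 : 0 ≤ Lw d * ‖gradR n M W‖ := mul_nonneg hLw hgW0
  have e3 := mul_le_mul_of_nonneg_left hL (show (0 : ℝ) ≤ 1 + Lw d by positivity)
  unfold cF1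
  calc ‖gradR n M W‖ + Lw d / M₀ * ‖W‖ ≤ (1 + Lw d) * (‖gradR n M W‖ + ‖W‖) := by nlinarith [e1, e2]
    _ ≤ (1 + Lw d) * (cLT d * (C + |Cε ε|) * (holderT n M ε (fun ν => cplx (T ν)) + ‖T‖)) := e3

/-- pointwise additivity of `∇` (plumbing). [cite: Balaban1984PropagatorsI, (1.108) p.35] -/
theorem gradR_add_apply (u v : VecR n M) (ν : Fin d) (b : Bnd n M) :
    gradR n M (u + v) ν b = gradR n M u ν b + gradR n M v ν b := by
  rw [gradR_add]; rfl

set_option maxHeartbeats 400000 in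
/-- **(1.130) AS PRINTED, READ AT A PAIR — tensor source, Hölder-quotient functional (for (1.113))**: «Then we apply the
inequality (1.117) together with (1.115), (1.116) and we get ‖ζ∇h_zGh_z∇*J‖_α ≤ O(1)(‖ζ‖_α + |ζ|)(‖J‖_{α+ε} + |J|). (1.130)»:
for `0 ≤ α`, `0 < ε`, `α + ε < 1`, a pair `0 < |x − x′| ≤ 1`,
`|ζ(x′)(∇_ν h_zGh_z∇*T)_μ(x′) − ζ(x)(∇_ν h_zGh_z∇*T)_μ(x)| ≤ c1H·E·(‖ζ‖_α + |ζ|)·(‖T‖_{α+ε} + |T|)·|x − x′|^α` with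
`E = C + |C_α(α)| + |C_ε(ε)| + |C_{α,ε}(α,ε)|`. [cite: Balaban1984PropagatorsI, (1.130) p.38, (1.115)–(1.117) p.36] -/
theorem one_quotH_ten_le (hn : 1 ≤ n) (hM₀ : 1 ≤ M₀) (hC : 0 ≤ C)
    (hG : B5.Global115_117 (latticeSettingP12R n M a k) (gP12R M n a k) C Cα Cε Cαε) (z : Cen M M₀)
    (T : Fin d → VecR n M) {α ε : ℝ} (hα0 : 0 ≤ α) (hε0 : 0 < ε) (hαε : α + ε < 1) (ζ : Tor (fine n M) → ℝ)
    (ν μ : Fin d) {x x' : Tor (fine n M)} (h1 : distU n M x x' ≤ 1) (h0 : 0 < distU n M x x') :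
    |ζ x' * gradR n M (fun b' => gz n M M₀ z b' * (GR n M a *ᵥ fun b'' => gz n M M₀ z b'' * divTR n M T b'') b') ν (x', μ)
        - ζ x * gradR n M (fun b' => gz n M M₀ z b' * (GR n M a *ᵥ fun b'' => gz n M M₀ z b'' * divTR n M T b'') b') ν (x, μ)|
      ≤ c1H d * (C + |Cα α| + |Cε ε| + |Cαε α ε|) * (holS n M α ζ + cutSupL n M ζ)
          * (holderT n M (α + ε) (fun ν => cplx (T ν)) + ‖T‖) * distU n M x x' ^ α := by
  have hα1 : α < 1 := by linarith
  have hε1 : ε < 1 := by linarith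
  have hαε1 : α + ε ≤ 1 := hαε.le
  set src : VecR n M := fun b'' => gz n M M₀ z b'' * divTR n M T b'' with hsrc
  set W : VecR n M := GR n M a *ᵥ src with hW
  set N := holderT n M (α + ε) (fun ν => cplx (T ν)) + ‖T‖ with hN
  set E := C + |Cα α| + |Cε ε| + |Cαε α ε| with hE
  have ht : 0 ≤ distU n M x x' ^ α := Real.rpow_nonneg h0.le α
  have hT0 := norm_nonneg T
  have hH0 : 0 ≤ holderT n M (α + ε) (fun ν => cplx (T ν)) := by
    unfold holderT holderSeminormB5; exact LatticeNorms.holderSeminorm_nonneg _ _ _ _ _ _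
  have hN0 : 0 ≤ N := add_nonneg hH0 hT0
  have hTN : ‖T‖ ≤ N := by rw [hN]; linarith
  have hCa := abs_nonneg (Cα α); have hCe := abs_nonneg (Cε ε); have hCae := abs_nonneg (Cαε α ε)
  have hE0 : 0 ≤ E := by positivity
  have hCE : C ≤ E := by rw [hE]; linarith
  have hCaE : |Cα α| ≤ E := by rw [hE]; linarith
  have hCeE : C + |Cε ε| ≤ E := by rw [hE]; linarith
  have hCaeE : |Cαε α ε| ≤ E := by rw [hE]; linarith
  have hS : 0 ≤ holS n M α ζ := holS_nonneg (n := n) (M := M) α ζ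
  have hZ : 0 ≤ cutSupL n M ζ := cutSupL_nonneg' (n := n) (M := M) ζ
  have hLw := Lw_nonneg d
  have hKm := Kmix_nonneg
  have hd : (0 : ℝ) ≤ d := Nat.cast_nonneg d
  have h3 := Lw_div_le (d := d) hM₀
  have h4 := div_sq_le hM₀ Kmix_nonneg
  have hcLT : 0 ≤ cLT d := le_trans zero_le_one one_le_cLT
  -- sizes of `W`, `∇W` ((1.129) and its second inequality)
  have hL : ‖gradR n M W‖ + ‖W‖ ≤ cLT d * E * N := by
    have h := last_ten_le k hn hM₀ hC hG z T hε0 hε1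
    rw [← hsrc, ← hW] at h
    have hm := holderT_add_norm_mono (n := n) (M := M) T (ε := ε) hα0
    rw [← hN] at hm
    have hpos : 0 ≤ holderT n M ε (fun ν => cplx (T ν)) + ‖T‖ := by
      refine add_nonneg ?_ hT0
      unfold holderT holderSeminormB5; exact LatticeNorms.holderSeminorm_nonneg _ _ _ _ _ _
    calc ‖gradR n M W‖ + ‖W‖ ≤ cLT d * (C + |Cε ε|) * (holderT n M ε (fun ν => cplx (T ν)) + ‖T‖) := h
      _ ≤ cLT d * E * N := mul_le_mul (mul_le_mul_of_nonneg_left hCeE hcLT) hm hpos (by positivity)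
  have hgW : ‖gradR n M W‖ ≤ cLT d * E * N := le_trans (le_add_of_nonneg_right (norm_nonneg W)) hL
  have hW0 : ‖W‖ ≤ cLT d * E * N := le_trans (le_add_of_nonneg_left (norm_nonneg _)) hL
  -- the Hölder datum of `∇W` at the pair: (1.117) for `h_zT` and (1.115) for `E_zT`
  have hsplit : W = GR n M a *ᵥ divTR n M (fun ν b => gz n M M₀ z b * T ν b) + GR n M a *ᵥ Ediv (gz n M M₀ z) T := by
    rw [hW, hsrc, gz_divTR_eq, Matrix.mulVec_add]
  have hQ : |gradR n M W ν (x', μ) - gradR n M W ν (x, μ)|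
      ≤ (|Cαε α ε| * ((1 + Lw d) * N) + |Cα α| * (d * Lw d * N)) * distU n M x x' ^ α := by
    rw [hsplit, gradR_add_apply, gradR_add_apply]
    have hA := abs_sub_le_holderT_mul α (gradR n M (GR n M a *ᵥ divTR n M fun ν b => gz n M M₀ z b * T ν b)) ν μ h1 h0
    have hB := abs_sub_le_holderT_mul α (gradR n M (GR n M a *ᵥ Ediv (gz n M M₀ z) T)) ν μ h1 h0
    -- (1.117) for the source `h_zT`
    have h117 := holderT_gradR_G_divTR_le_of_global k hG hα0 hε0 hαε (fun ν b => gz n M M₀ z b * T ν b)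
    have hsz : holderT n M (α + ε) (fun ν => cplx fun b => gz n M M₀ z b * T ν b)
        + ‖(fun ν b => gz n M M₀ z b * T ν b : Fin d → VecR n M)‖ ≤ (1 + Lw d) * N := by
      have ha := holderT_gz_mul_le hn hM₀ z T hαε1
      have hb := norm_gz_mul_ten_le z T
      have e1 : Lw d / M₀ * ‖T‖ ≤ Lw d * ‖T‖ := mul_le_mul_of_nonneg_right h3 hT0
      have e2 : Lw d * ‖T‖ ≤ Lw d * N := mul_le_mul_of_nonneg_left hTN hLw
      rw [hN] at e2 ⊢
      linarith
    have hpos1 : 0 ≤ holderT n M (α + ε) (fun ν => cplx fun b => gz n M M₀ z b * T ν b)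
        + ‖(fun ν b => gz n M M₀ z b * T ν b : Fin d → VecR n M)‖ := by
      refine add_nonneg ?_ (norm_nonneg _)
      unfold holderT holderSeminormB5; exact LatticeNorms.holderSeminorm_nonneg _ _ _ _ _ _
    have hA' : holderT n M α (fun ν' => cplx (gradR n M (GR n M a *ᵥ divTR n M fun ν b => gz n M M₀ z b * T ν b) ν'))
        ≤ |Cαε α ε| * ((1 + Lw d) * N) := by
      refine h117.trans ?_
      calc Cαε α ε * _ ≤ |Cαε α ε| * _ := mul_le_mul_of_nonneg_right (le_abs_self _) hpos1
        _ ≤ |Cαε α ε| * ((1 + Lw d) * N) := mul_le_mul_of_nonneg_left hsz hCae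
    -- (1.115) for the source `E_zT`
    have h115 := holderT_gradR_G_le_of_global k hG hα0 hα1 (Ediv (gz n M M₀ z) T)
    have hB' : holderT n M α (fun ν' => cplx (gradR n M (GR n M a *ᵥ Ediv (gz n M M₀ z) T) ν')) ≤ |Cα α| * (d * Lw d * N) := by
      refine h115.trans ?_
      have hEn := norm_Ediv_le hn hM₀ z T
      have hE2 : ‖(Ediv (gz n M M₀ z) T : VecR n M)‖ ≤ d * Lw d * N := by
        refine hEn.trans ?_
        have := mul_le_mul_of_nonneg_left h3 hd
        exact mul_le_mul this hTN hT0 (by positivity)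
      calc Cα α * ‖(Ediv (gz n M M₀ z) T : VecR n M)‖ ≤ |Cα α| * ‖(Ediv (gz n M M₀ z) T : VecR n M)‖ :=
            mul_le_mul_of_nonneg_right (le_abs_self _) (norm_nonneg _)
        _ ≤ |Cα α| * (d * Lw d * N) := mul_le_mul_of_nonneg_left hE2 hCa
    calc |gradR n M (GR n M a *ᵥ divTR n M fun ν b => gz n M M₀ z b * T ν b) ν (x', μ)
          + gradR n M (GR n M a *ᵥ Ediv (gz n M M₀ z) T) ν (x', μ)
          - (gradR n M (GR n M a *ᵥ divTR n M fun ν b => gz n M M₀ z b * T ν b) ν (x, μ)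
            + gradR n M (GR n M a *ᵥ Ediv (gz n M M₀ z) T) ν (x, μ))|
        = |(gradR n M (GR n M a *ᵥ divTR n M fun ν b => gz n M M₀ z b * T ν b) ν (x', μ)
            - gradR n M (GR n M a *ᵥ divTR n M fun ν b => gz n M M₀ z b * T ν b) ν (x, μ))
          + (gradR n M (GR n M a *ᵥ Ediv (gz n M M₀ z) T) ν (x', μ)
            - gradR n M (GR n M a *ᵥ Ediv (gz n M M₀ z) T) ν (x, μ))| := by ring_nf
      _ ≤ _ := abs_add_le _ _
      _ ≤ holderT n M α (fun ν' => cplx (gradR n M (GR n M a *ᵥ divTR n M fun ν b => gz n M M₀ z b * T ν b) ν'))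
            * distU n M x x' ^ α
          + holderT n M α (fun ν' => cplx (gradR n M (GR n M a *ᵥ Ediv (gz n M M₀ z) T) ν')) * distU n M x x' ^ α :=
          add_le_add hA hB
      _ ≤ |Cαε α ε| * ((1 + Lw d) * N) * distU n M x x' ^ α + |Cα α| * (d * Lw d * N) * distU n M x x' ^ α :=
          add_le_add (mul_le_mul_of_nonneg_right hA' ht) (mul_le_mul_of_nonneg_right hB' ht)
      _ = _ := by ring
  -- the Leibniz pair estimate for `∇(h_zW)` and the cut-off product
  have hP := pair_gradR_gz_mul_le hn hM₀ z ν hα1.le W μ h1 h0 hQ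
  set F : VecR n M := gradR n M (fun b => gz n M M₀ z b * W b) ν with hF
  have hF1 : ∀ y : Tor (fine n M), F (y, μ) = gradR n M (fun b => gz n M M₀ z b * W b) ν (y, μ) := fun y => rfl
  have hcut := pair_cut_le α ζ F μ h1 h0 (by rw [hF1, hF1]; exact hP)
  refine hcut.trans (mul_le_mul_of_nonneg_right ?_ ht)
  -- sizes against `X := c1H·E·N`
  have hFn : ‖F‖ ≤ (1 + Lw d) * (cLT d * E * N) := by
    refine (norm_le_pi_norm _ ν).trans ((norm_gradR_gz_mul_le hn hM₀ z W).trans ?_)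
    have e1 : Lw d / M₀ * ‖W‖ ≤ Lw d * (cLT d * E * N) := mul_le_mul h3 hW0 (norm_nonneg _) hLw
    linarith [e1, hgW]
  have hQ'' : Lw d / M₀ * ‖gradR n M W‖ + (|Cαε α ε| * ((1 + Lw d) * N) + |Cα α| * (d * Lw d * N))
        + (d * (Kmix / (M₀ : ℝ) ^ 2) * ‖W‖ + Lw d / M₀ * (d * ‖gradR n M W‖))
      ≤ (Lw d + d * Kmix + d * Lw d) * (cLT d * E * N) + (1 + Lw d + d * Lw d) * (E * N) := by
    have e1 : Lw d / M₀ * ‖gradR n M W‖ ≤ Lw d * (cLT d * E * N) := mul_le_mul h3 hgW (norm_nonneg _) hLw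
    have e2 : d * (Kmix / (M₀ : ℝ) ^ 2) * ‖W‖ ≤ d * Kmix * (cLT d * E * N) := by
      have h' := mul_le_mul h4 hW0 (norm_nonneg _) hKm
      calc (d : ℝ) * (Kmix / (M₀ : ℝ) ^ 2) * ‖W‖ = d * (Kmix / (M₀ : ℝ) ^ 2 * ‖W‖) := by ring
        _ ≤ d * (Kmix * (cLT d * E * N)) := mul_le_mul_of_nonneg_left h' hd
        _ = d * Kmix * (cLT d * E * N) := by ring
    have e3 : Lw d / M₀ * (d * ‖gradR n M W‖) ≤ Lw d * (d * (cLT d * E * N)) :=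
      mul_le_mul h3 (mul_le_mul_of_nonneg_left hgW hd) (by positivity) hLw
    have e4 : |Cαε α ε| * ((1 + Lw d) * N) ≤ E * ((1 + Lw d) * N) := mul_le_mul_of_nonneg_right hCaeE (by positivity)
    have e5 : |Cα α| * (d * Lw d * N) ≤ E * (d * Lw d * N) := mul_le_mul_of_nonneg_right hCaE (by positivity)
    linarith [e1, e2, e3, e4, e5]
  have hcFH1 : 1 + Lw d ≤ cFH d := by
    unfold cFH
    have : 0 ≤ (d : ℝ) * Kmix := mul_nonneg hd hKm
    have : 0 ≤ (d : ℝ) * Lw d := mul_nonneg hd hLw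
    linarith
  have hcFH2 : Lw d + d * Kmix + d * Lw d ≤ cFH d := by unfold cFH; linarith
  have hrest : 0 ≤ 1 + Lw d + d * Lw d := by positivity
  have hX1 : (1 + Lw d) * (cLT d * E * N) ≤ c1H d * E * N := by
    have h' : (1 + Lw d) * cLT d ≤ c1H d := by
      unfold c1H
      have := mul_le_mul_of_nonneg_right hcFH1 hcLT
      linarith
    have := mul_le_mul_of_nonneg_right h' (mul_nonneg hE0 hN0)
    linarith [this]
  have hX2 : (Lw d + d * Kmix + d * Lw d) * (cLT d * E * N) + (1 + Lw d + d * Lw d) * (E * N) ≤ c1H d * E * N := by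
    have h' : (Lw d + d * Kmix + d * Lw d) * cLT d + (1 + Lw d + d * Lw d) ≤ c1H d := by
      unfold c1H
      have := mul_le_mul_of_nonneg_right hcFH2 hcLT
      linarith
    have := mul_le_mul_of_nonneg_right h' (mul_nonneg hE0 hN0)
    linarith [this]
  have key := combine_le hS hZ (hFn.trans hX1) (hQ''.trans hX2)
  linarith [key]

end One

end

end Literature.MathematicalPhysics.QuantumFieldTheory.Balaban1983to89.B5SupFactor125Torus
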